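/-
Copyright (c) 2026 the pub-hodgecm-mathlib formalisation cell (harness21).  Prover seat hodgecm-mathlib-F0P3a-p03 (g21), 2026-09-02 (LH7 leaf ED. 3 road, O8b census:
the algebraic LOCAL half of the isotypy letter (O8b♭), third tool — the «DET-SCALAR» package: ALL of `G` acts through `χ`).
-/
import Literature.NumberTheory.Automorphic.SmoothRepUniqueConstituentCompact      -- ★ p850220∕p850252: `IrrClass.apply_eq_smul_of_forall_isConstituentOf_eq_of_mem_closure`
import Literature.NumberTheory.Automorphic.SmoothRepUniqueConstituentCentral      -- ★ p850270: `IrrClass.apply_eq_smul_of_forall_isConstituentOf_eq_of_sq`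
import HarnessLib

/-!
# A smooth representation with a UNIQUE constituent `χ`: if `t²` is a scalar-acting element times a product of compact-subgroup elements, `ρ(t) = χ(t)`

Topic `NumberTheory/Automorphic`; namespace `Literature.NumberTheory.Automorphic` (dot notation on ★ `IrrClass`).  THEOREMS ONLY: no definition, no named fact, no
instance, no notation, no `sorry`.  Third tool of the «unique constituent ⇒ isotypy» kit (★ `SmoothRepUniqueConstituentCompact`: every subgroup contained in a compact set, and the
subgroup `G°` they generate, act through `χ`; ★ `SmoothRepUniqueConstituentCentral`: an operator central in `ρ(G)` with scalar square acts through `χ`).  This file COMBINES them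
into the shape in which a `p`-adic group is actually consumed — no generation statement `G = G°` and no unitarity are needed:

THE MATHEMATICS («DET-SCALAR» road).  Let `ρ` be a smooth representation of the topological group `G` on `V` whose only constituent (★ `IrrClass.IsConstituentOf`) is the class of
an irreducible `τ` on which `G` acts through the character `χ` (open kernel).  Write `G° := ⟨K ≤ G | K ⊆ compact⟩` (the `Subgroup.closure` of the union of the subgroups contained in
compact sets; ★ p850252 makes `G°` act through `χ`).  Let `t ∈ G` and suppose
* (`hcomm`) every commutator `g⁻¹ t⁻¹ g t` (`g ∈ G`) lies in `G°` — then `ρ(g) ρ(t) = ρ(t) ρ(g) ρ(g⁻¹t⁻¹gt) = ρ(t) ρ(g) χ(g⁻¹t⁻¹gt) = ρ(t) ρ(g)` (a character kills commutators), i.e.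
  `ρ(t)` is CENTRAL in `ρ(G)`;
* (`hz`, `hsq`) there is `z ∈ G` acting on `V` by a SCALAR `c` (in the applications: `z` central in an ambient topologically irreducible unitary representation — Schur) with
  `t · t · z⁻¹ ∈ G°` — then `ρ(t)² = ρ(t t z⁻¹) ρ(z) = χ(t t z⁻¹) c` is a SCALAR.
Then ★ p850270 `…_of_sq` gives `ρ(t) = χ(t)`.  For `G = GL₂(F)` or `U(1,1)(E∕F)` over a non-archimedean local field EVERY `t` qualifies with `z = det t · 1` (resp. the norm-one
scalar `det t · 1`): `t² (det t)⁻¹` and all commutators have determinant `1`, and `SL₂(F)` (resp. `SU(1,1)`) is generated by transvections, each inside a compact subgroup —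
whence the name.  So the «`∀ t`» corollary `…_of_forall_exists_sq_mul_inv_mem_closure` turns «unique constituent `⟦ℂ_χ⟧` + the centre acts by scalars + `{t² z_t⁻¹} ∪ [G,G] ⊆ G°`»
into «`G` acts through `χ`», with no case distinction between split and non-split places and no weak∕strong approximation.
* §1 `IrrClass.apply_eq_smul_of_forall_isConstituentOf_eq_of_sq_mul_inv_mem_closure` (abstract `τ`) — one `t`;
* §2 `…_eq_mk_ofChar_of_sq_mul_inv_mem_closure` (`τ = ℂ_χ`, the currency of ★ `Realises₂` ∕ ★ `LocalConstituentsIn`) and the `∀ t` corollaries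
  `…_of_forall_exists_sq_mul_inv_mem_closure` ∕ `…_eq_mk_ofChar_of_forall_exists_sq_mul_inv_mem_closure`.
CONSUMER (cell `hodgecm-mathlib`, crux H413, line LH7, (O8b♭) local): `Summits/…/Theorems/F0P3cPKtupleU2LocalIsotypy` — `Realises₂ P₂ ξ ⇒` ALL of `U(Φ₂)(L⁺_v)` acts on the
finite-adelic smooth vectors of `P₂` through `((η ψ) ∘ det) ∘ ι_v`, at every finite place `v`.
HONEST LABEL: generic smooth representation theory ([BushnellHenniart2006] §2.3, §9.1; [BernsteinZelevinsky1976] §2.1–§2.3); HC_CM is proved only modulo the printed citations of that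
programme until its rung 0 closes; this file proves no printed citation of it.

## References
* [BushnellHenniart2006] C. J. Bushnell, G. Henniart, *The local Langlands conjecture for GL(2)*, Grundlehren 335 (2006), §2.3 Lemma, §9.1 (twisting), §9.2.
* [BernsteinZelevinsky1976] I. N. Bernstein, A. V. Zelevinsky, Russian Math. Surveys 31:3 (1976), §2.1–§2.3.
-/

set_option autoImplicit false

noncomputable section

namespace Literature.NumberTheory.Automorphic

namespace IrrClass

universe u

variable {G : Type u} [Group G] [TopologicalSpace G] [IsTopologicalGroup G]

/-! ## §1 One element `t`: commutators in `G°`, `t² z⁻¹ ∈ G°` with `z` acting by a scalar ⇒ `ρ(t) = χ(t)` -/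

/-- **«DET-SCALAR» LEMMA (abstract `τ`).**  Let `ρ` be smooth on `V` with every constituent equal to `⟦τ⟧`, `τ` irreducible with `τ.ρ g = χ(g)` (`hτ`), `χ` with open kernel; write
`G°` for the subgroup closure of `⋃ {K ≤ G | IsCompact ↑K}`.  Let `t z ∈ G`, `c ∈ ℂ` with `ρ z = c • id` on `V` (`hz`), `t · t · z⁻¹ ∈ G°` (`hsq`) and `g⁻¹ t⁻¹ g t ∈ G°` for every `g`
(`hcomm`).  Then `ρ t v = χ(t) • v`.  (`G°` acts through `χ` by ★ p850252; hence `ρ(t)` commutes with `ρ(G)` and `ρ(t)² = χ(t t z⁻¹) c` is a scalar; conclude by ★ p850270.)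
[cite: BushnellHenniart2006, §2.3 Lemma; §9.1] [cite: BernsteinZelevinsky1976, §2.1–§2.3] -/
theorem apply_eq_smul_of_forall_isConstituentOf_eq_of_sq_mul_inv_mem_closure {V : Type} [AddCommGroup V] [Module ℂ V]
    (ρ : Representation ℂ G V) (hρ : ρ.IsSmooth) (χ : G →* ℂˣ) (hχ : IsOpen ((χ.ker : Subgroup G) : Set G))
    (τ : SmoothIrrep G) (hτ : ∀ (g : G) (z : τ.V), τ.ρ g z = ((χ g : ℂˣ) : ℂ) • z)
    (hconst : ∀ c : IrrClass G, c.IsConstituentOf ρ → c = IrrClass.mk τ)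
    (t z : G) (c : ℂ) (hz : ∀ v : V, ρ z v = c • v)
    (hsq : t * t * z⁻¹ ∈ Subgroup.closure (⋃ K ∈ {K : Subgroup G | IsCompact (K : Set G)}, (K : Set G)))
    (hcomm : ∀ g : G, g⁻¹ * t⁻¹ * g * t ∈ Subgroup.closure (⋃ K ∈ {K : Subgroup G | IsCompact (K : Set G)}, (K : Set G)))
    (v : V) : ρ t v = ((χ t : ℂˣ) : ℂ) • v := by
  -- `G°` acts through `χ`
  have hN : ∀ {n : G}, n ∈ Subgroup.closure (⋃ K ∈ {K : Subgroup G | IsCompact (K : Set G)}, (K : Set G)) →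
      ∀ w : V, ρ n w = ((χ n : ℂˣ) : ℂ) • w := fun hn w =>
    apply_eq_smul_of_forall_isConstituentOf_eq_of_mem_closure ρ hρ χ hχ τ hτ hconst hn w
  -- a character kills commutators
  have hχk : ∀ g : G, χ (g⁻¹ * t⁻¹ * g * t) = 1 := fun g => by
    rw [show g⁻¹ * t⁻¹ * g * t = (t * g)⁻¹ * (g * t) by group, map_mul, map_inv, map_mul, map_mul, mul_comm (χ g),
      inv_mul_cancel]
  -- `ρ(t)` is central in `ρ(G)`
  have hcomm' : ∀ (g : G) (w : V), ρ g (ρ t w) = ρ t (ρ g w) := fun g w => by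
    calc ρ g (ρ t w) = ρ (g * t) w := by rw [map_mul, Module.End.mul_apply]
      _ = ρ (t * g * (g⁻¹ * t⁻¹ * g * t)) w := by rw [show t * g * (g⁻¹ * t⁻¹ * g * t) = g * t by group]
      _ = ρ t (ρ g (ρ (g⁻¹ * t⁻¹ * g * t) w)) := by rw [map_mul, map_mul, Module.End.mul_apply, Module.End.mul_apply]
      _ = ρ t (ρ g w) := by rw [hN (hcomm g), hχk g, Units.val_one, one_smul]
  -- `ρ(t)²` is a scalar
  have hsq' : ∀ w : V, ρ t (ρ t w) = ((((χ (t * t * z⁻¹) : ℂˣ) : ℂ)) * c) • w := fun w => by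
    calc ρ t (ρ t w) = ρ (t * t * z⁻¹ * z) w := by rw [inv_mul_cancel_right, map_mul, Module.End.mul_apply]
      _ = ρ (t * t * z⁻¹) (ρ z w) := by rw [map_mul, Module.End.mul_apply]
      _ = ((((χ (t * t * z⁻¹) : ℂˣ) : ℂ)) * c) • w := by rw [hz, map_smul, hN hsq, smul_smul, mul_comm]
  exact apply_eq_smul_of_forall_isConstituentOf_eq_of_sq ρ hρ χ τ hτ hconst t _ hsq' hcomm' v

/-- **The `∀ t` form (abstract `τ`)**: if EVERY commutator lies in `G°` (`hcomm`) and for EVERY `t` there is a scalar-acting `z` with `t t z⁻¹ ∈ G°` (`hcen`), then ALL of `G` acts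
through `χ` on `V`. [cite: BushnellHenniart2006, §2.3 Lemma; §9.1] [cite: BernsteinZelevinsky1976, §2.1–§2.3] -/
theorem apply_eq_smul_of_forall_isConstituentOf_eq_of_forall_exists_sq_mul_inv_mem_closure {V : Type} [AddCommGroup V] [Module ℂ V]
    (ρ : Representation ℂ G V) (hρ : ρ.IsSmooth) (χ : G →* ℂˣ) (hχ : IsOpen ((χ.ker : Subgroup G) : Set G))
    (τ : SmoothIrrep G) (hτ : ∀ (g : G) (z : τ.V), τ.ρ g z = ((χ g : ℂˣ) : ℂ) • z)
    (hconst : ∀ c : IrrClass G, c.IsConstituentOf ρ → c = IrrClass.mk τ)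
    (hcen : ∀ t : G, ∃ (z : G) (c : ℂ), (∀ v : V, ρ z v = c • v) ∧
      t * t * z⁻¹ ∈ Subgroup.closure (⋃ K ∈ {K : Subgroup G | IsCompact (K : Set G)}, (K : Set G)))
    (hcomm : ∀ g t : G, g⁻¹ * t⁻¹ * g * t ∈ Subgroup.closure (⋃ K ∈ {K : Subgroup G | IsCompact (K : Set G)}, (K : Set G)))
    (t : G) (v : V) : ρ t v = ((χ t : ℂˣ) : ℂ) • v := by
  obtain ⟨z, c, hz, hsq⟩ := hcen t
  exact apply_eq_smul_of_forall_isConstituentOf_eq_of_sq_mul_inv_mem_closure ρ hρ χ hχ τ hτ hconst t z c hz hsq (fun g => hcomm g t) v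

/-! ## §2 `τ = ℂ_χ` -/

/-- **«DET-SCALAR» LEMMA with `τ := ℂ_χ`** (★ `SmoothIrrep.ofChar χ hχ`): unique constituent `⟦ℂ_χ⟧`, `ρ z = c • id`, `t t z⁻¹ ∈ G°`, all `g⁻¹t⁻¹gt ∈ G°` ⇒ `ρ t v = χ(t) • v`.
[cite: BushnellHenniart2006, §2.3 Lemma; §9.1] -/
theorem apply_eq_smul_of_forall_isConstituentOf_eq_mk_ofChar_of_sq_mul_inv_mem_closure {V : Type} [AddCommGroup V] [Module ℂ V]
    (ρ : Representation ℂ G V) (hρ : ρ.IsSmooth) (χ : G →* ℂˣ) (hχ : IsOpen ((χ.ker : Subgroup G) : Set G))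
    (hconst : ∀ c : IrrClass G, c.IsConstituentOf ρ → c = IrrClass.mk (SmoothIrrep.ofChar χ hχ))
    (t z : G) (c : ℂ) (hz : ∀ v : V, ρ z v = c • v)
    (hsq : t * t * z⁻¹ ∈ Subgroup.closure (⋃ K ∈ {K : Subgroup G | IsCompact (K : Set G)}, (K : Set G)))
    (hcomm : ∀ g : G, g⁻¹ * t⁻¹ * g * t ∈ Subgroup.closure (⋃ K ∈ {K : Subgroup G | IsCompact (K : Set G)}, (K : Set G)))
    (v : V) : ρ t v = ((χ t : ℂˣ) : ℂ) • v :=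
  apply_eq_smul_of_forall_isConstituentOf_eq_of_sq_mul_inv_mem_closure ρ hρ χ hχ (SmoothIrrep.ofChar χ hχ)
    (fun g z => by rw [SmoothIrrep.ofChar_ρ_apply]; rfl) hconst t z c hz hsq hcomm v

/-- **The `∀ t` form with `τ := ℂ_χ`** — the shape consumed at the finite places of the (O8b♭) isotypy letter: unique constituent `⟦ℂ_χ⟧`, every commutator in `G°`, and for every
`t` a scalar-acting `z` with `t t z⁻¹ ∈ G°` ⇒ ALL of `G` acts through `χ`. [cite: BushnellHenniart2006, §2.3 Lemma; §9.1] -/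
theorem apply_eq_smul_of_forall_isConstituentOf_eq_mk_ofChar_of_forall_exists_sq_mul_inv_mem_closure {V : Type} [AddCommGroup V] [Module ℂ V]
    (ρ : Representation ℂ G V) (hρ : ρ.IsSmooth) (χ : G →* ℂˣ) (hχ : IsOpen ((χ.ker : Subgroup G) : Set G))
    (hconst : ∀ c : IrrClass G, c.IsConstituentOf ρ → c = IrrClass.mk (SmoothIrrep.ofChar χ hχ))
    (hcen : ∀ t : G, ∃ (z : G) (c : ℂ), (∀ v : V, ρ z v = c • v) ∧
      t * t * z⁻¹ ∈ Subgroup.closure (⋃ K ∈ {K : Subgroup G | IsCompact (K : Set G)}, (K : Set G)))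
    (hcomm : ∀ g t : G, g⁻¹ * t⁻¹ * g * t ∈ Subgroup.closure (⋃ K ∈ {K : Subgroup G | IsCompact (K : Set G)}, (K : Set G)))
    (t : G) (v : V) : ρ t v = ((χ t : ℂˣ) : ℂ) • v :=
  apply_eq_smul_of_forall_isConstituentOf_eq_of_forall_exists_sq_mul_inv_mem_closure ρ hρ χ hχ (SmoothIrrep.ofChar χ hχ)
    (fun g z => by rw [SmoothIrrep.ofChar_ρ_apply]; rfl) hconst hcen hcomm t v

/-- **`χ = 1`**: unique TRIVIAL constituent, every commutator in `G°`, and for every `t` a scalar-acting `z` with `t t z⁻¹ ∈ G°` ⇒ `G` acts TRIVIALLY.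
[cite: BushnellHenniart2006, §2.3 Lemma] -/
theorem apply_eq_self_of_forall_isConstituentOf_eq_mk_ofChar_one_of_forall_exists_sq_mul_inv_mem_closure {V : Type} [AddCommGroup V] [Module ℂ V]
    (ρ : Representation ℂ G V) (hρ : ρ.IsSmooth) (h1 : IsOpen (((1 : G →* ℂˣ).ker : Subgroup G) : Set G))
    (hconst : ∀ c : IrrClass G, c.IsConstituentOf ρ → c = IrrClass.mk (SmoothIrrep.ofChar 1 h1))
    (hcen : ∀ t : G, ∃ (z : G) (c : ℂ), (∀ v : V, ρ z v = c • v) ∧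
      t * t * z⁻¹ ∈ Subgroup.closure (⋃ K ∈ {K : Subgroup G | IsCompact (K : Set G)}, (K : Set G)))
    (hcomm : ∀ g t : G, g⁻¹ * t⁻¹ * g * t ∈ Subgroup.closure (⋃ K ∈ {K : Subgroup G | IsCompact (K : Set G)}, (K : Set G)))
    (t : G) (v : V) : ρ t v = v := by
  have h2 := apply_eq_smul_of_forall_isConstituentOf_eq_mk_ofChar_of_forall_exists_sq_mul_inv_mem_closure ρ hρ 1 h1 hconst hcen hcomm t v
  rwa [MonoidHom.one_apply, Units.val_one, one_smul] at h2

end IrrClass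

end Literature.NumberTheory.Automorphic

end
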